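import Summits.ResolutionOfSingularities.ResolutionOfSingularities.Theorems.EquisingularLiftEquisingularLiftNatLargeCharRung
import Summits.ResolutionOfSingularities.ResolutionOfSingularities.Theorems.EquisingularLiftEquisingularLiftNatLargeCharRoof
import HarnessLib

/-!
# EL♮(3) / EL♮(n), RUNG LC «large characteristic» — DOOR CURRENCY: in characteristic `p > M(n, d)` every integral degree-`d` hypersurface of `ℙⁿ_k̄`
# carries the smooth-parameter descent door `DescDoorSharp` (D18♯), hence lies in blob E11

leafhand-res-equisingularlift-4 g0 (prover, 2026-08-31; one-generation line-first hand on stmt-ResolutionOfSingularities-20148 / -20038 / -15660, cell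
`pub/decomp-res`).  Crux `EquisingularLiftNatThree` (`stmt-…-20148`; uniform in `n`, so also `stmt-…-20038`), line W4.5(b), RUNG LC (idea-2 g32
`Cruxes/EquisingularLiftNatThree/LARGE-CHAR-RUNG-idea2.md` v1.6 §4 (c2) «every generic member of an explicit `ℤ`-flat family is D18♯-served for `p` outside a finite
INEFFECTIVE set … a customer ESCAPING D18♯ must be a small-characteristic specimen»).  The rung ✓ `LargeChar.elnat_largeChar` (…NatLargeCharRung, this hand) composes
the funded spread ✓ `LargeChar.spread_holds` with the engine; this file records the DOOR-LEVEL reading the residue stubs' case analysis consumes, DEF-FREE: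

* ★ `descDoorSharp_largeChar` — `∃ M(n, d), ∀ p > M, ∀ k` algebraically closed of characteristic `p`, every `ι : H ⟶ ℙⁿ_k` with `H` integral and
  `range ι = V₊(F)`, `F ≠ 0` of degree `d`: `DescDoorSharp k n H ι` (✓ `largeChar_roof` with `Door = Concl := DescDoorSharp`, engine `id`, spread ✓ `spread_holds`);
* `blobE11_largeChar` — hence blob E11 `NoseHypHostedNestEquinodalDirectCILiftTowerZeroPrimeSigmaPGBTriplePrimeDescSharp₂ k n H ι` (✓ …DefsE11, `Or.inr`): for each
  degree, the would-be 54th (D18♯) nose residue and the D19-ISO drawer have ONLY SMALL-CHARACTERISTIC content (`p ≤ M(n, d)`) — an honest LEAF TAG, not a close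
  (the registered stubs quantify over all `p` and all degrees).

EL♮(3) NOT proved; EL♮ NOT proved; resolution of singularities in positive characteristic NOT proved; nothing of [Hironaka2017] (a candidate under adjudication) is
asserted or used.  [OURS · pure composition · standard axioms · DEF-FREE · ZERO named hypotheses · `--supports stmt-ResolutionOfSingularities-20148 --as helper`, counted 0 ·
AI-written, weaker than expert review.] [folklore]
-/

set_option linter.dupNamespace false -- mandated namespace `Summit.<Summit>.<Problem>` of this single-conjunct summit

noncomputable section

open CategoryTheory AlgebraicGeometry
open MvPolynomial
open Literature.AlgebraicGeometry.Resolution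

namespace Summit.ResolutionOfSingularities.ResolutionOfSingularities.Cruxes.EquisingularLiftNat.Sections.LargeChar

/-- ★ **The D18♯ door in large characteristic, degree by degree**: `∃ M(n, d)` such that for every prime `p > M`, every algebraically closed `k` of
characteristic `p`, every `ι : H ⟶ ℙⁿ_k` with `H` integral whose range is the zero locus of a non-zero degree-`d` form `F`: `DescDoorSharp k n H ι`.
[OURS · L1 W4.5b · RUNG LC door currency; EL♮(3) NOT proved] -/
theorem descDoorSharp_largeChar (n d : ℕ) :
    ∃ M : ℕ, ∀ (p : ℕ), p.Prime → ∀ (k : Type) [Field k] [CharP k p] [IsAlgClosed k], M < p →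
      ∀ (H : Scheme.{0}) (ι : H ⟶ (Literature.AlgebraicGeometry.Motives.projectiveSpace n k).left)
        (F : MvPolynomial (Fin (n + 1)) k), F.IsHomogeneous d →
        (IsIntegral H ∧ F ≠ 0 ∧
          letI := MvPolynomial.gradedAlgebra (σ := Fin (n + 1)) (R := k)
          Set.range ι = {x : Proj (homogeneousSubmodule (Fin (n + 1)) k) | F ∈ x.asHomogeneousIdeal}) →
        DescDoorSharp k n H ι :=
  largeChar_roof n d
    (fun k _ H ι F =>
      IsIntegral H ∧ F ≠ 0 ∧
        letI := MvPolynomial.gradedAlgebra (σ := Fin (n + 1)) (R := k)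
        Set.range ι = {x : Proj (homogeneousSubmodule (Fin (n + 1)) k) | F ∈ x.asHomogeneousIdeal})
    (fun k _ _ H ι => DescDoorSharp k n H ι) (fun k _ _ H ι => DescDoorSharp k n H ι)
    (spread_holds n d) (fun _ _ _ _ _ _ _ _ h => h)

/-- **Blob E11 in large characteristic**: under the same hypotheses, `NoseHypHostedNestEquinodalDirectCILiftTowerZeroPrimeSigmaPGBTriplePrimeDescSharp₂ k n H ι`
(blob E10 `∨ DescDoorSharp`, ✓ …DefsE11) holds by its second arm — degree by degree, the D18♯ residue has only small-characteristic content (a LEAF TAG; the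
registered stubs quantify over all `p`). [OURS · pure logic; EL♮(3) NOT proved] -/
theorem blobE11_largeChar (n d : ℕ) :
    ∃ M : ℕ, ∀ (p : ℕ), p.Prime → ∀ (k : Type) [Field k] [CharP k p] [IsAlgClosed k], M < p →
      ∀ (H : Scheme.{0}) (ι : H ⟶ (Literature.AlgebraicGeometry.Motives.projectiveSpace n k).left)
        (F : MvPolynomial (Fin (n + 1)) k), F.IsHomogeneous d →
        (IsIntegral H ∧ F ≠ 0 ∧
          letI := MvPolynomial.gradedAlgebra (σ := Fin (n + 1)) (R := k)
          Set.range ι = {x : Proj (homogeneousSubmodule (Fin (n + 1)) k) | F ∈ x.asHomogeneousIdeal}) →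
        NoseHypHostedNestEquinodalDirectCILiftTowerZeroPrimeSigmaPGBTriplePrimeDescSharp₂ k n H ι := by
  obtain ⟨M, hM⟩ := descDoorSharp_largeChar n d
  exact ⟨M, fun p hp k _ _ _ hMp H ι F hF hcut => Or.inr (hM p hp k hMp H ι F hF hcut)⟩

end Summit.ResolutionOfSingularities.ResolutionOfSingularities.Cruxes.EquisingularLiftNat.Sections.LargeChar

end
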